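import Summits.QuantumFields.YangMills.Theorems.InfiniteVolumeReflectionPositivityOn
import Summits.QuantumFields.YangMills.Theorems.InfiniteVolumeContinuumDataOn
import Summits.QuantumFields.YangMills.Theorems.LangevinControlUVOSLegsFromFemtoAndGapStubAssemblyHermitian
import Summits.QuantumFields.YangMills.Theorems.InfiniteVolumeHyperoctahedralOn
import HarnessLib

/-!
# Infinite volume by compactness, class-parametric form V: the class package with E2, hermiticity and hyperoctahedral
# invariance

HONEST FRAMING (cell `ym-fleet`, seat `ym-infvol-p2`, director-ym R136 (i); count-neutral helper for the route owner's
ruling on the «torus parity» junction (ym-beyond-p2 g20 2026-08-26T18:17:23Z, (c′)∕(E)); companion of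
`InfiniteVolumeMomentBoundsOnSides`, `InfiniteVolumeContinuumDataOn`, `InfiniteVolumeReflectionPositivityOn`,
`InfiniteVolumeHyperoctahedralOn`).  Pure soft analysis, kernel-checked.  The ceilings `TorusClass.MomentBounds6OnSides G r a 𝓣` are a HYPOTHESIS (owed E0′).
NOTHING is asserted about Bałaban's renormalisation group, rotations (E1), non-triviality (NT∕NG), a mass gap, or Clay.

**`exists_ivDataOn_onSides_rp`**: from `MomentBounds6OnSides G r a 𝓣`, `𝓣` unbounded, `a > 0`, `a → 0`: couplings
`β_k → ∞`, ONE strictly increasing `N` with `N k + 1 ∈ 𝓣`, states `IsInfiniteVolumeLimitAlong r.ρ (β k) N (μ k)`, and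
`(S₁, T)` with the DATA-clause convergence (centre smearing), E0, hermiticity, E0′, **E2 (`RPPos` and
`IsReflectionPositive`)**, E3, translation invariance on `⁰𝒮`, **invariance under all signed permutations**, Schwartz
bounds — every clause of the route's existence-half leaf EXCEPT full E1 (only its hyperoctahedral part) and NT∕NG (those consume the spine's odd-torus legs `ROT`, `LowerBounds`; said plainly).
With `𝓣 = familySides` (`TorusClass.familySides_unbounded`) the data are read on Track A's own family tori. [folklore]

References: K. Osterwalder, E. Seiler, Ann. Phys. 110 (1978) §2; J. Glimm, A. Jaffe, Quantum Physics (1987) §6.1.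
-/

set_option autoImplicit false

noncomputable section

open scoped SchwartzMap BigOperators
open MeasureTheory Filter Topology
open Literature.MathematicalPhysics.QuantumFieldTheory hiding ZdEdge
open Literature.MathematicalPhysics.QuantumLattice
open Literature.MathematicalPhysics.AQFT
open Literature.Probability.LatticeModels (box Site)
open Summit.QuantumFields.YangMills.Cruxes.OSLegsFromFemtoAndGap.DlrCollarTransfer (RPPos)
open Summit.QuantumFields.YangMills.Theorems.OSLegsFromFemtoAndGap (isHermitian_of_isReflectionPositive)
open Summit.QuantumFields.YangMills.Cruxes.UV.TorusClass (MomentBounds6OnSides)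
open Summit.QuantumFields.YangMills.Cruxes.OSLegsAtWeakCouplingC.Sketch (Invariant IsSignedPerm)

namespace Summit.QuantumFields.YangMills.Theorems.InfiniteVolume

open Summit.QuantumFields.YangMills.Theorems.InfVolRP (rpPos_of_limitStates_centre)

variable {G : Type} [Group G] [TopologicalSpace G] [IsTopologicalGroup G] [CompactSpace G]
  [MeasurableSpace G] [BorelSpace G]

/-- **The «`L → ∞` first» continuum data on the tori of ANY unbounded class of raw sides, with E2 and the
hyperoctahedral symmetries.**  From
`TorusClass.MomentBounds6OnSides G r a 𝓣`, `𝓣` unbounded, `a > 0`, `a → 0`: couplings `β_k → ∞`, ONE strictly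
increasing `N` with `N k + 1 ∈ 𝓣`, states `μ_k` with `IsInfiniteVolumeLimitAlong r.ρ (β k) N (μ k)`, and `(S₁, T)`
with the DATA-clause convergence (centre smearing), E0 (`IsNormalized`), hermiticity, E0′ (`HasLinearGrowth`), E2
(`RPPos` and `IsReflectionPositive`), E3 (`IsSymmetric`), translation invariance on `⁰𝒮`, invariance under all signed
permutations of the axes, and the Schwartz bounds.  NOT produced: full E1 (rotations beyond the hyperoctahedral group) and NT∕NG (they consume the spine's odd-torus legs `ROT` ∕ `LowerBounds`). [folklore] -/
theorem exists_ivDataOn_onSides_rp (r : LatticeRep G) {a : ℝ → ℝ} (hapos : ∀ β, 0 < a β)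
    (ha0 : Tendsto a atTop (𝓝 0)) {𝓣 : Set ℕ} (hMB : MomentBounds6OnSides G r a 𝓣)
    (h𝓣 : ∀ m : ℕ, ∃ M ∈ 𝓣, m ≤ M) :
    ∃ (β : ℕ → ℝ) (N : ℕ → ℕ) (μ : ℕ → Measure (LGConfig 4 G)) (S₁ : SchwingerFamily (EuclideanSpace ℝ (Fin 4)))
      (T : (n : ℕ) → (Fin n → Fin 4 × Fin 4) → (𝓢((Fin n → EuclideanSpace ℝ (Fin 4)), ℂ) →L[ℂ] ℂ)),
      Tendsto β atTop atTop ∧ StrictMono N ∧ (∀ k, N k + 1 ∈ 𝓣) ∧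
      (∀ k, IsInfiniteVolumeLimitAlong (d := 4) r.ρ (β k) N (μ k)) ∧
      (∀ F : 𝓢((Fin 0 → EuclideanSpace ℝ (Fin 4)), ℂ), S₁ 0 F = F default) ∧
      (∀ F : 𝓢((Fin 1 → EuclideanSpace ℝ (Fin 4)), ℂ), S₁ 1 F = 0) ∧
      (∀ n : ℕ, 2 ≤ n → ∀ F : 𝓢((Fin n → EuclideanSpace ℝ (Fin 4)), ℂ),
        S₁ n F = ∑ q ∈ Fintype.piFinset (fun _ : Fin n => Finset.univ.filter fun p : Fin 4 × Fin 4 => p.1 < p.2),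
          T n q F) ∧
      (∀ n : ℕ, 2 ≤ n → ∀ q : Fin n → Fin 4 × Fin 4, (∀ i, (q i).1 < (q i).2) →
        ∀ F : 𝓢((Fin n → EuclideanSpace ℝ (Fin 4)), ℂ), IsOffDiagonal F →
          Tendsto (fun k => ∑' x : Fin n → Site 4, ((stateMomentStr G r (μ k) n q x : ℝ) : ℂ) *
            F (fun l => a (β k) • siteToE (x l) +
              (a (β k) / 2) • (EuclideanSpace.single (q l).1 (1 : ℝ) + EuclideanSpace.single (q l).2 (1 : ℝ))))
            atTop (𝓝 (T n q F))) ∧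
      S₁.toLabelled.IsNormalized ∧ S₁.toLabelled.IsHermitian ∧ S₁.toLabelled.HasLinearGrowth ∧
      RPPos S₁ ∧ S₁.toLabelled.IsReflectionPositive ∧ S₁.toLabelled.IsSymmetric ∧
      (∀ (n : ℕ) (t : EuclideanSpace ℝ (Fin 4)) (F : 𝓢((Fin n → EuclideanSpace ℝ (Fin 4)), ℂ)), IsOffDiagonal F →
        S₁ n (translateMulti t F) = S₁ n F) ∧
      (∀ R : EuclideanSpace ℝ (Fin 4) ≃ₗᵢ[ℝ] EuclideanSpace ℝ (Fin 4), IsSignedPerm R → Invariant S₁ R) ∧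
      (∃ K : ℝ, 0 ≤ K ∧ (∀ n q F, ‖T n q F‖ ≤ 5 * K ^ n * schwartzNorm (10 * n) F) ∧
        ∀ n F, ‖S₁ n F‖ ≤ 5 * (6 * K) ^ n * schwartzNorm (10 * n) F) := by
  -- a faithful continuous matrix representation of the compact group makes it Hausdorff and second countable
  haveI : T2Space G := (r.continuous.isClosedEmbedding r.injective).isEmbedding.t2Space
  haveI : SecondCountableTopology G :=
    (r.continuous.isClosedEmbedding r.injective).isEmbedding.secondCountableTopology
  obtain ⟨β, N, μ, S₁, T, hβ, hN, hN𝓣, hμ, h0, h1, h2, hconv, hE0, hLG, hE3, htr, hbds⟩ :=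
    exists_ivDataOn_onSides r hapos ha0 hMB h𝓣
  have hmem : ∀ k, μ k ∈ infiniteVolumeLimitPoints (d := 4) r.ρ (β k) := fun k => ⟨N, hN, hμ k⟩
  obtain ⟨hRP, hE2⟩ := rpPos_of_limitStates_centre r (hβ.eventually_ge_atTop 0) μ hmem (fun k => hapos (β k))
    (ha0.comp hβ) T hconv S₁ h2 h0 h1
  have hsigned := signedPerm_invariant_of_limitStates r (fun k => a (β k)) β μ S₁ T hmem h0 h1 h2 hconv
  exact ⟨β, N, μ, S₁, T, hβ, hN, hN𝓣, hμ, h0, h1, h2, hconv, hE0, isHermitian_of_isReflectionPositive S₁ hE0 hE2,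
    hLG, hRP, hE2, hE3, htr, hsigned, hbds⟩

end Summit.QuantumFields.YangMills.Theorems.InfiniteVolume

end
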